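import Mathlib
import HarnessLib
import HarnessLib.Audit
import Summits.SmoothPoincare4.Statement
import Literature.Topology.FourManifolds.IntersectionNumbers
import Literature.Topology.FourManifolds.SphereFamilySurgery
import HarnessLib.Audit.Status.Attr

/-!
Route: ThreePointSpheres

DORMANT since 2026-08-23T00:25:02Z (reconciler: no traction for 5.8 d (last activity item-evidence-added at 2026-08-17T04:55:38Z); parked, not closed — `ledger route dormant route-SmoothPoincare4-ThreePointSpheres --off` to reactivate) — unstaffed, not closed; items shared with open routes are served there. `ledger route dormant <id> --off` reactivates.

# Route ThreePointSpheres — SPC4 at Morgan–Szabó complexity two — every fake S⁴ is a three-point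
sphere pair over S⁴, and three-point pairs cancel

It suffices to show X = DESCENT₃ ∧ CANCEL₃, rung C = 2 of the Morgan–Szabó/Ladu complexity ladder
(card first-protocork-three-point-spheres).
DESCENT₃ (items SpherePresentation then ThreePointDescent): every smooth homotopy 4-sphere —
literally the Statement's data: M : Type, Hausdorff, second countable, a C^∞ atlas modelled on ℝ⁴
and
e : M ≃ₕ S⁴ (M is then compact and simply connected; no packaging structure) — is obtained from a
closed simply connected smooth
4-manifold N carrying ONE algebraically dual pair (S, P) of framed embedded 2-spheres (transverse,
S·P = 1) meeting in exactly THREE points,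
surgery along P giving S⁴ and surgery along S giving M — i.e. M is the top of an h-cobordism from S⁴
of Morgan–Szabó complexity ≤ 2,
a twist of S⁴ along Ladu's unique complexity-2 protocork P₀. CANCEL₃ (item ThreePointCancellation =
RUNG(P₀) of the card): every such
three-point presentation from S⁴ yields M ≃ₘ S⁴. Both halves are typed verbatim in the tree's
Milnor/Matveyev middle-level vocabulary
(FramedSphereFamily, IsAlgebraicallyDual, doublePoints, FramedSphereFamily.IsSurgery), the data of
the named facts (B)/(H4) of
CorkDecompositionMiddleLevel.lean; no new definition is needed to state X.
Lean: `(∀ (M : Type) [TopologicalSpace M] [T2Space M] [SecondCountableTopology M] [ChartedSpace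
(EuclideanSpace ℝ (Fin 4)) M] [IsManifold (𝓡 4) ∞ M], M ≃ₕ Metric.sphere (0 : EuclideanSpace ℝ (Fin
5)) 1 → ∃ (N : Type) (_ : TopologicalSpace N) (_ : T2Space N) (_ : SecondCountableTopology N) (_ :
ChartedSpace (EuclideanSpace ℝ (Fin 4)) N) (_ : IsManifold (𝓡 4) ∞ N) (_ : CompactSpace N) (_ :
SimplyConnectedSpace N) (oN : Literature.Topology.FourManifolds.SmoothOrientation (𝓡 4) N) (oS oP :
Literature.Topology.FourManifolds.SmoothOrientation (𝓡 2) (Metric.sphere (0 : EuclideanSpace ℝ (Fin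
3)) 1)) (S P : Literature.Topology.FourManifolds.FramedSphereFamily (𝓡 4) N (Fin 1) 2 2),
Literature.Topology.FourManifolds.IsAlgebraicallyDual (𝓡 2) (𝓡 2) (𝓡 4) two_add_two_eq_four oS oP oN
S.sphere P.sphere ∧ (Literature.Topology.FourManifolds.doublePoints (S.sphere 0) (P.sphere 0)).ncard
= 3 ∧ P.IsSurgery (𝓡 4) (Metric.sphere (0 : EuclideanSpace ℝ (Fin 5)) 1) ∧ S.IsSurgery (𝓡 4) M) ∧ (∀
(M : Type) [TopologicalSpace M] [T2Space M] [SecondCountableTopology M] [ChartedSpace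
(EuclideanSpace ℝ (Fin 4)) M] [IsManifold (𝓡 4) ∞ M] (_ : M ≃ₕ Metric.sphere (0 : EuclideanSpace ℝ
(Fin 5)) 1) (N : Type) [TopologicalSpace N] [T2Space N] [SecondCountableTopology N] [ChartedSpace
(EuclideanSpace ℝ (Fin 4)) N] [IsManifold (𝓡 4) ∞ N] [CompactSpace N] [SimplyConnectedSpace N] (oN :
Literature.Topology.FourManifolds.SmoothOrientation (𝓡 4) N) (oS oP :
Literature.Topology.FourManifolds.SmoothOrientation (𝓡 2) (Metric.sphere (0 : EuclideanSpace ℝ (Fin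
3)) 1)) (S P : Literature.Topology.FourManifolds.FramedSphereFamily (𝓡 4) N (Fin 1) 2 2),
Literature.Topology.FourManifolds.IsAlgebraicallyDual (𝓡 2) (𝓡 2) (𝓡 4) two_add_two_eq_four oS oP oN
S.sphere P.sphere → (Literature.Topology.FourManifolds.doublePoints (S.sphere 0) (P.sphere 0)).ncard
= 3 → P.IsSurgery (𝓡 4) (Metric.sphere (0 : EuclideanSpace ℝ (Fin 5)) 1) → S.IsSurgery (𝓡 4) M →
Nonempty (M ≃ₘ⟮𝓡 4, 𝓡 4⟯ Metric.sphere (0 : EuclideanSpace ℝ (Fin 5)) 1))`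

## Assembly
Deciding theorem (D-0027 §2.1), pure logic over the Statement's own binders: `SmoothPoincare4`
unfolds to
∀ (M : Type) [T2Space M] [SecondCountableTopology M] (atlas) (IsManifold (𝓡 4) ∞ M), M ≃ₕ S⁴ →
Nonempty (M ≃ₘ⟮𝓡 4, 𝓡 4⟯ S⁴); given e,
SpherePresentation presents M from S⁴ by an algebraically dual middle-level pair of framed sphere
families, ThreePointDescent trades it for
ONE pair with exactly three double points, ThreePointCancellation returns the diffeomorphism:
`theorem closes (hP : SpherePresentation) (hD : ThreePointDescent) (hC : ThreePointCancellation) :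
SmoothPoincare4` (6 tactic lines; planner
folder Sketch.lean = the rendered file: lean check rc 0, 0 sorries, axioms
propext/Classical.choice/Quot.sound, #h21_check_closes ok,
route's own items). Repair 2026-08-15:
the items formerly quantified over the packaging structure `HomotopySphere 4`, whose glue needed the
compactness/orientability packaging
facts outside the import cone; they are restated 1:1 over the Statement's binders (Q.carrier ↦ M)
and the import
Literature.Topology.FourManifolds.HomotopySpheres is dropped. Compactness of M (Hatcher 3.29, tree
fact
compactSpace_of_homotopyEquiv_sphere_four_holds) and simple connectivity (transport along e) are
derived by item provers in Theorems files
where needed. The optional Assembly item states the same implication and is closable by the same six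
lines.

Rationale: WHY THIS LINE. Mechanism: grade SPC4 by the complexity C(Z) of the h-cobordism Z : S⁴ → Σ that every
homotopy 4-sphere tops (Θ₄ = 0, KervaireMilnorAnnals1963;
Z is unique by Kreck2001, so C is an invariant of Σ): C is even and C = 0 iff Z is a product
(MorganSzabo1999; Schwartz2020 Def. 2.3), and
C = 2 iff Z has a normal decomposition with ONE 2- /3-handle pair whose belt and attaching spheres
meet thrice with signs +,−,+, i.e. iff Σ is a
twist of S⁴ along the unique complexity-2 protocork P₀ (Ladu2025ComplexityTwo §6.1, Fig. 1;
Ladu2022Protocorks Def. 2.1, Prop. 2.16) — so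
SPC4 becomes a conjunction of rungs indexed by finite signed bipartite graphs with a UNIQUE bottom
rung, unlike trisection genus, 2-handle number
or shadow complexity whose first open rung is an infinite family. Imported areas: 5-dimensional
handle theory read in the middle level
(MilnorHCobordism1965 Def. 3.11/Thm. 3.13, KirbyCorks1996 §2, Matveyev1996: algebraically dual
framed sphere families and surgery, exactly the
tree's vocabulary), and 4-dimensional light-bulb isotopy as the engine for CANCEL₃ (Gabai2020;
Schwartz2021LightBulbDisks and
KosanovicTeichner2021Disks close the dual-visible and wrapping-number-1 sectors, leaving one Whitney
circle); monopole Floer theory enters only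
negatively (Ladu2025ComplexityTwo Thm. 1.1/Cor. 1.3: the twist involution of ∂P₀ extends over
neither side of any P₀-supported cork in S⁴,
e.g. the Akbulut cork, so no rung-2 instance is standard by an extension argument and a global
isotopy is required). Versus route Stabilisation
(S1: Σ # S²×S² ≅ S²×S²; S2: one-summand cancellation; negatives index empty): CANCEL₃ is the
three-point special case of S2 — one notch beyond
OnePointCancellation (= Milnor cancellation, C = 0, support) — and DESCENT₃ strengthens S1 (one
summand AND excess 2); the cut is moved so that
the cancellation side is the smallest configuration the light-bulb theorems do not yet cover and the
descent side carries the open weight with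
a finite, canonical first rung. No spectral/probabilistic/physical reformulation is used: none bears
on a single Whitney circle.

RANKED CRUXES. #0 Target (target) — X = DESCENT₃ ∧ CANCEL₃: (every homotopy 4-sphere has a one-pair,
three-point, algebraically dual presentation from S⁴ by surgery) ∧ (every such presentation yields
S⁴). X ⟺ SPC4 (⇐ by a finger move on the factor spheres of S²×S²). (why it might fail: X ⟺ SPC4,
false iff an exotic S⁴ exists (Gluck twists of non-ribbon 2-knots, Cappell–Shaneson spheres outside
Gompf's families and P₀-twists of S⁴ are undecided candidates); and the split may put all the weight
on DESCENT₃.) [Kirby1997, FreedmanGompfMorrisonWalker2010, Ladu2025ComplexityTwo, MorganSzabo1999]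
#2 SpherePresentation (crux) — FACT-GATE (placed first by the Phase-C rule: the assembly is
conditional on two UNPROVED named facts). Every homotopy 4-sphere Σ admits an algebraically dual
middle-level presentation from S⁴: a closed simply connected smooth 4-manifold N, orientations, k,
framed families S, P of k disjoint 2-spheres in N
(Literature.Topology.FourManifolds.FramedSphereFamily), algebraically dual (IsAlgebraicallyDual:
transverse, Sᵢ·Pⱼ = δᵢⱼ), with S⁴ obtained from N by surgery along P and Σ by surgery along S
(FramedSphereFamily.IsSurgery). It is Θ₄ = 0 in h-cobordism form (named fact
Literature.Topology.FourManifolds.isHCobordant_sphere_of_homotopySphere_four, UNPROVED: 4 open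
leaves in ThetaFourKervaireMilnor.lean) + IsHCobordant.symm (proved) + two-three handle trading
(PROVED: exists_isMorseFunction_two_three_of_isHCobordism_holds) + the middle-level fact (B)
Literature.Topology.FourManifolds.exists_dualSpheres_middleLevel_of_two_three (UNPROVED; fact seat
provefact-Literature.Topology.FourManifolds.corkDecomposition) at X₁ = S⁴, X₂ = M (universe 0; S⁴
simply connected by simplyConnectedSpace_sphere_four_holds, M compact by
compactSpace_of_homotopyEquiv_sphere_four_holds and simply connected by transport along e : M ≃ₕ
S⁴). [difficulty: M] (why it might fail: true on paper (KM63 p.504; Milnor65 Thm 3.13 + Kirby96 §2);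
the risk is formal: both inputs are UNPROVED named facts whose Lean forms (universe-u ∃-families,
IsSurgery as open gluing, orientations, cobordism direction) must match this ∃-form — unprovable
until Θ₄ and (B) land.) [KervaireMilnorAnnals1963, MilnorHCobordism1965, KirbyCorks1996,
Matveyev1996, WallJLMS1964]
#3 ThreePointCancellation (crux) — CANCEL₃ = RUNG(P₀) (card item K1, sphere form (b)): for every
homotopy 4-sphere Σ, every closed simply connected smooth oriented 4-manifold N and ONE pair of
framed embedded 2-spheres S, P ⊂ N (FramedSphereFamily over Fin 1) that is algebraically dual
(transverse, S·P = 1) with exactly 3 double points, if surgery along P gives S⁴ and surgery along S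
gives Σ then Σ ≅ S⁴. Then N ≅ S²×S² with P isotopic to pt×S² and [S] = [S²×pt]; equivalently:
h-cobordisms of Morgan–Szabó complexity 2 that start at S⁴ end at S⁴; every twist of S⁴ along Ladu's
protocork P₀ with simply connected result is S⁴ (this includes the Akbulut cork and the DHM cork
(1,0,1) in EVERY embedding into S⁴, Ladu2025ComplexityTwo §1). The mathematically hardest and most
informative item of the route. [difficulty: open-problem] (why it might fail: = SPC4 for P₀-twists:
a three-point pair whose every Whitney disc meets S ∪ P inside (dual-invisible) escapes
Gabai/Schwartz/KT light bulbs and may surger to an exotic S⁴; τ on ∂P₀ extends over neither side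
(Ladu Cor 1.3); the analogue is FALSE at b⁺ ≥ 1 (Akbulut cork twists are P₀-supported).)
[Ladu2025ComplexityTwo, Gabai2020, Schwartz2021LightBulbDisks, KosanovicTeichner2021Disks,
FreedmanGompfMorrisonWalker2010, Akbulut1991Fake]
#4 ThreePointDescent (crux) — DESCENT (card item K2, complexity reduction): every algebraically dual
presentation (N, k, S, P) of a homotopy 4-sphere Σ from S⁴ (as in SpherePresentation) can be
replaced by one with k = 1 and exactly 3 double points presenting the same Σ from S⁴. Equivalently:
the minimum of the Morgan–Szabó complexity over h-cobordisms S⁴ → Σ is ≤ 2 (there is one such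
h-cobordism up to diffeomorphism, Kreck2001, so: C(Z_Σ) ≤ 2 — every fake 4-sphere is a P₀-twist of
S⁴; C = 0 presentations are converted to three points by one finger move). Implies Stabilisation's
S1 (one S²×S² summand suffices) since N ≅ Σ # S²×S² ≅ S²×S². [difficulty: open-problem] (why it
might fail: no complexity-REDUCING handle move is known; SW forces C > N at b⁺ ≥ 1 (MorganSzabo1999
Thm 1.1, Ladu2025 Thm 1.2) and even 'one 2- /3-handle pair suffices' is open for closed pairs
(Schwartz2020 §2; false for corks, Kang2022): an exotic Σ needing two S²×S² summands or excess ≥ 4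
refutes it.) [MorganSzabo1999, Ladu2025ComplexityTwo, Schwartz2020, Kang2022OneStabilization,
Kreck2001, WallJLMS1964]
#9 OnePointCancellation (support) — rung C = 0 (calibration; the last step of any light-bulb proof
of ThreePointCancellation, after a Whitney move): the same data with S, P GEOMETRICALLY dual
(IsGeometricallyDual: algebraically dual with exactly one double point) ⇒ Σ ≅ S⁴. Milnor's
cancellation theorem read in the middle level: ν(S ∪ P) is a punctured S²×S², N ≅ N₀ # S²×S² with S,
P the two factors, both surgeries return N₀, hence Σ ≅ N₀ ≅ S⁴ (MilnorHCobordism1965 Thms 5.4/6.4;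
KirbyCorks1996 §1 prototype; GompfStipsicz1999 §5.2). Known mathematics; the formal work is the
plumbing/gluing bookkeeping over IsSurgery. [difficulty: L] [MilnorHCobordism1965, KirbyCorks1996,
GompfStipsicz1999, Matveyev1996]

TWO-LAYER PLAN. Foreseen glued splits (k ≤ 3, depth 1; nothing filed now). ThreePointCancellation ⇐
DualVisibleCancellation → DualInvisibleVanishes →
ThreePointCancellation: DualVisibleCancellation = "if some framed Whitney disc W for a cancelling
pair of S ∩ P has interior disjoint from
S ∪ P (w = 0) then Σ ≅ S⁴" (Whitney move to OnePointCancellation; provable once a 4-d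
framed-Whitney-disc notion exists, with Gabai2020 as a
named fact for the variant through a common dual), DualInvisibleVanishes = "every three-point pair
presenting a homotopy sphere from S⁴ has
w = 0" (the genuine residue, graded by the card's (j, w)). ThreePointDescent ⇐ OnePairDescent (k =
1, any excess: Stabilisation's S1 in
middle-level form, to be shared) → ExcessReduction (k = 1: reduce the excess to 2 keeping Σ) →
ThreePointDescent. SpherePresentation ⇐ glue
from the two named facts (IsHCobordant.symm, exists_isMorseFunction_two_three_of_isHCobordism_holds,
then (B)), filed when Θ₄ and (B) land.

KILL CRITERIA. ¬ThreePointCancellation or ¬ThreePointDescent proved (a Theorems refutation) exhibits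
an exotic S⁴: SPC4 is refuted and the route closes
`refuted:<Decl>` together with the summit (the witness goes to the lasagna / s-invariant detector
routes). Soft kills: Stabilisation's
StabCancellation (S2) proved ⇒ ThreePointCancellation is a corollary and the route shrinks to
DESCENT₃ (keep as the descent route, re-rank);
ThreePointDescent shown equivalent to SPC4 by an argument not passing through CANCEL₃ (the cut is
illusory) ⇒ close `superseded --by
route-SmoothPoincare4-Stabilisation`; SpherePresentation bounced as TYPED when Θ₄/(B) land in a
different Lean form ⇒ restate 1:1, never close.

NOT DECOMPOSED YET. The (j, w) grading of rung 2 and the dual-visible sector theorem (need a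
4-dimensional framed Whitney disc notion and Gabai2020 as a named
fact — definition request D2, cite later); the cork and disc-knot languages (c)/(d) of the card
(IsCork/IsCorkTwist exist, 'supported by the
protocork P₀' does not — D3); Kreck uniqueness of the h-cobordism S⁴ → Σ (not needed: DESCENT
quantifies over all presentations); higher rungs
C = 4, 6, … (finitely many protocorks each, Ladu2025ComplexityTwo §6.1) — branches of
¬ThreePointDescent, later and planner-owned; the
identification N ≅ S²×S² inside ThreePointCancellation (a lemma provers attach with --supports, not
an item); the census engine of the card
(kit enumeration of band presentations of Mazur-pattern slice discs in S²×D², feeding candidate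
two-2-handle spheres to refuters) — evidence
attached to ThreePointCancellation, not an item.

CHEAPEST FALSIFIER. (1) Lookup, run first: is an exotic-candidate homotopy 4-sphere known to need
two S²×S² summands or excess ≥ 4 in every one-pair
h-cobordism from S⁴ (stabilisation-complexity > 1, Schwartz2020 §2 'currently unknown';
FreedmanGompfMorrisonWalker2010 §3)? A positive
answer kills ThreePointDescent at once. (2) Typed-statement sanity (refuter, Lean only): build the
finger-move three-point presentation of S⁴
(N = S²×S², S = S²×pt pushed through P = pt×S² twice) in the tree's FramedSphereFamily/IsSurgery
vocabulary — it shows the hypotheses of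
ThreePointCancellation are satisfiable and that ncard = 2 is excluded by S·P = 1 (parity); if the
hypotheses turn out unsatisfiable as typed
the cruxes are vacuous and must be restated. (3) Kit (not run in plancard mode): enumerate band
presentations (≤ 3 bands) of proper discs in
S²×D² bounded by the wrapping-3 Mazur pattern, form the two-2-handle diagrams of the surgered
spheres and run handle-slide/collapse search; a
persistent survivor is a concrete candidate against CANCEL₃. What I ran: lean check of Sketch.lean
(rc 0) and of the assembly proof (rc 0,
0 sorries); nothing refuting. Repair pass 2026-08-15: the rendered repaired file (items over the
Statement's binders + `closes`) lean check rc 0,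
0 sorries, #h21_check_closes ok, deps cone clean.

NUMBERS. C(Z) ∈ {0, 2, 4, …}; C = 0 ⟺ product (MorganSzabo1999; Schwartz2020 Def. 2.3: C = min over
(2,3)-handlebodies of Σᵢⱼ |Aᵢ ⋔ Bⱼ| − δᵢⱼ);
C = 2 ⟺ one pair, 3 points, signs +,−,+ ⟺ P₀-twist, and finitely many protocorks below any
complexity bound (Ladu2025ComplexityTwo §6.1,
pp. 15–16, Fig. 1); HM(∂P₀): τ_*(x₀) = x₀ + Δ with U·Δ = 0 (Thm. 1.1); at b⁺ ≥ 1: ≥ 2·17·17!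
h-cobordisms E(1)#17CP²bar → X₁#17CP²bar of
complexity ≥ 4 and complexity > N after #m_N CP²bar (Thm. 1.2); the Akbulut cork and the DHM cork
(1,0,1) are P₀-supported (§1). Light-bulb
coverage: discs with a dual sphere in the boundary at wrapping number 1 are unique rel ∂
(KosanovicTeichner2021Disks), spheres/discs with a
framed geometric dual are determined by homotopy (Gabai2020, Schwartz2021LightBulbDisks); the Mazur
pattern has wrapping number 3.
Items at open: 6 (1 target, 3 cruxes, 1 support, 1 assembly). Repair 2026-08-15 (route-repair
planner): Target, SpherePresentation, ThreePointCancellation,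
ThreePointDescent, OnePointCancellation restated 1:1 over the Statement's own binders (Q :
HomotopySphere 4 ↦ M : Type + T2 + second countable +
ℝ⁴-atlas + IsManifold + e : M ≃ₕ S⁴; Q.carrier ↦ M; mathematics unchanged), import HomotopySpheres
dropped, deciding theorem `closes` supplied.

DEFINITION REQUESTS. D1 `hCobordismComplexity` (Morgan–Szabó; topic
Literature/Topology/FourManifolds): for an h-cobordism c : Cobordism 4 X₁ X₂ between simply
connected closed 4-manifolds, the minimum over two-three Morse functions / middle-level
presentations (N, k, S, P) as in (B) of
Σᵢⱼ (doublePoints (S.sphere i) (P.sphere j)).ncard − k — enables rungs C ≥ 4 and the cite facts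
MorganSzabo1999 Thm 1.1, Ladu2025 §6.1/Thm 1.2.
D2 `FramedWhitneyDisc` for a pair of transverse immersed/embedded surfaces in a smooth 4-manifold
(Freedman–Quinn §1.4; Whitney circle, framing
condition, interior intersections) — needed to type the dual-visible split of ThreePointCancellation
and the (j, w) grading.
D3 (low priority) Ladu's protocork `Protocork Γ` of a signed bipartite graph and `IsProtocorkTwist`
(Ladu2022Protocorks Defs 2.1–2.3, Prop. 2.16)
for the cork language of the card. Cite facts wanted later: Gabai2020 Thm 1.2 (4D light bulb
theorem) over the tree's embedded-sphere vocabulary.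

Novelty: Searches (2026-08-15): `lit search "Morgan Szabo complexity h-cobordisms four-manifolds
Seiberg-Witten"` (local 1: Schwartz2020 =
paper:arxiv-1811.02753, READ Def. 2.3 and §2; OpenAlex/S2/arXiv HTTP 429, Crossref 10 irrelevant);
`lit search --source zbmath "complexity
h-cobordism"` (5; relevant: Schwartz2020 only); `lit search --source local "protocork"` (0 held);
`lit read arxiv:2501.08750` (fetched, 23 pp.;
READ p. 1, p. 2, §6.1 pp. 15–16: C = 2 ⟺ P₀, unique complexity-2 graph, finiteness per bound,
P₀-supported corks; grep 'S^4|homotopy sphere':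
no statement about S⁴); `lit galaxy search "complexity of h-cobordisms" | "protocork" | "light bulb
theorem" --star all` (0 / noise);
`lit frontier SmoothPoincare4 --since 2021` (30 rows; none on h-cobordism complexity or sphere pairs
in S²×S²); hub: 23 Theses files of the
sub grepped for protocork / Morgan–Szabó / Ladu / complexity (0 mechanisms; nearest Stabilisation
S1/S2); `lean search` located the middle-level
vocabulary and facts (B)/(H4) (CorkDecompositionMiddleLevel.lean) the statements are written in;
`ledger negatives --problem SmoothPoincare4` (0).
Nearest prior art found: Ladu2025ComplexityTwo (arXiv:2501.08750: C = 2 ⟺ P₀-twist, HM(∂P₀),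
obstructions at b⁺ ≥ 1; no S⁴ statement),
MorganSzabo1999 / Schwartz2020 (complexity and its growth via SW at b⁺ = 1), route Stabilisation
with FreedmanGompfMorrisonWalker2010 §3 and
arXiv:1009.0514 (the S1/S2 split), KirbyCorks1996 / Matveyev1996 (middle-level dual spheres, the
tree's  [refs: 2501.08750, 1009.0514, paper:arxiv-1811.02753, arxiv:2501.08750, Schwartz2020, MorganSzabo1999, FreedmanGompfMorrisonWalker2010, KirbyCorks1996, Matveyev1996]

Barriers (technique_class: protocork-complexity-ladder, light-bulb, middle-level): - technique_class: protocork-complexity-ladder, light-bulb, middle-level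
- Literature.Barriers.SmoothPoincare4.HCobordismBarrierFour: the h-cobordism principle (h-cobordant
⇒ diffeomorphic, false by Donaldson) is never invoked — the h-cobordism only carries the complexity
grading; conceded that CANCEL₃'s analogue is FALSE at b⁺ ≥ 1 (P₀-supported Akbulut cork twists
change smooth structures, Ladu2025 §1; GompfStipsicz1999 §9.3), so it does not evade by technique:
the bet is that at b₂ = 0 the one-Whitney-circle configuration is exhaustible by light-bulb isotopy,
which is global and gauge-free.
- Literature.Barriers.SmoothPoincare4.RelativeContractibleBarrierFour: input, not obstruction —
CANCEL₃ asks for a global diffeomorphism, never for an extension of τ over the cork or its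
complement (for P₀-supported corks τ is strongly non-extendable, Ladu2025 Cor. 1.3, so extension
arguments are dead by design).
- Literature.Barriers.SmoothPoincare4.ContractibleBarrierFour: same — no identification of
homeomorphic contractible pieces is used; the objects are sphere pairs in a closed N.
- Literature.Barriers.SmoothPoincare4.OneStabilisationBarrier: hits ThreePointDescent by scope only
— DESCENT₃ implies that one S²×S² summand dissolves every homotopy 4-sphere (closed, b₂ = 0: Kang's
open Question 1), while Kang's theorem is about compact contractible manifolds with boundary; a
closed analogue of Kang's cork refutes DESCENT₃; conceded, it is the crux's stated risk.
- Literature.Barriers.S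

History (route lifecycle, newest last):
- 2026-08-15T16:53:19Z · rev 2: restated Target (stmt-SmoothPoincare4-7366), SpherePresentation (stmt-SmoothPoincare4-7367), ThreePointCancellation (stmt-SmoothPoincare4-7368), ThreePointDescent (stmt-SmoothPoincare4-7369), OnePointCancellation (stmt-SmoothPoincare4-7370) — route-repair (unit rbadge-SmoothPoincare4-ThreePointSpher-d0607d66-g4, (planner-rbadge-SmoothPoincare4-ThreePointSpher-d0607d66-g4-0)
- 2026-08-23T00:25:02Z · DORMANT — reconciler: no traction for 5.8 d (last activity item-evidence-added at 2026-08-17T04:55:38Z); parked, not closed — `ledger route dormant route-SmoothPoincare4- (operator:999:2089546)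

sub-problem: SmoothPoincare4 · status: dormant · opened planner-plancard-SmoothPoincare4-SmoothPoinca-65609b42-0 2026-08-15T12:08:33Z · rev 2 · ledger route-SmoothPoincare4-ThreePointSpheres
GENERATED by the gate from the ledger (D-0016/17). Provers cite these decls: `theorem foo : Summit.SmoothPoincare4.SmoothPoincare4.Theses.ThreePointSpheres.<Decl> := …` in Summits/SmoothPoincare4/SmoothPoincare4/Theorems/<Name>.lean.
-/

namespace Summit.SmoothPoincare4.SmoothPoincare4.Theses.ThreePointSpheres

open scoped BigOperators Topology Manifold Classical MeasureTheory ProbabilityTheory Matrix InnerProductSpace ComplexConjugate ContinuousMap ContDiff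
open Filter Set Function TopologicalSpace MeasureTheory

attribute [summit_statement] _root_.SmoothPoincare4

open Literature.SPC4

-- earlier Target (stmt-SmoothPoincare4-7366, replaced 2026-08-15T16:53:19Z -> stmt-SmoothPoincare4-11166): retired by None — (∀ Q : Literature.Topology.FourManifolds.HomotopySphere 4, ∃ (N : Type) (_ : TopologicalSpace N) (_ : T2Space N) (_ : SecondCountableTopology N) (_ : ChartedSpace (EuclideanSpace ℝ (Fin 4)) N) (_ : IsManifold (𝓡 4) ∞ N) (_ : CompactSpace N) (_ : SimplyConnectedSpace N) (oN : L
/-- item stmt-SmoothPoincare4-11166 · target · rank 0 · open · by planner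
why it might fail: X ⟺ SPC4, false iff an exotic S⁴ exists (Gluck twists of non-ribbon 2-knots, Cappell–Shaneson spheres outside Gompf's families and P₀-twists of S⁴ are undecided candidates); and the split may put all the weight on DESCENT₃.
sources: Kirby1997, FreedmanGompfMorrisonWalker2010, Ladu2025ComplexityTwo, MorganSzabo1999
[target] X = DESCENT₃ ∧ CANCEL₃, stated over the Statement's own binders (M : Type, Hausdorff,
second countable, C^∞ atlas modelled on ℝ⁴, e : M ≃ₕ S⁴; M is then compact — Hatcher 3.29, tree fact
compactSpace_of_homotopyEquiv_sphere_four_holds — and simply connected by transport along e; no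
packaging structure): (every such M has a one-pair, three-point, algebraically dual presentation
from S⁴ by surgery) ∧ (every such presentation yields M ≃ₘ S⁴). X ⟺ SPC4 (⇐ by a finger move on the
factor spheres of S²×S²). -/
@[route_item "route-SmoothPoincare4-ThreePointSpheres"]
def Target : Prop :=
  (∀ (M : Type) [TopologicalSpace M] [T2Space M] [SecondCountableTopology M] [ChartedSpace (EuclideanSpace ℝ (Fin 4)) M] [IsManifold (𝓡 4) ∞ M], M ≃ₕ Metric.sphere (0 : EuclideanSpace ℝ (Fin 5)) 1 → ∃ (N : Type) (_ : TopologicalSpace N) (_ : T2Space N) (_ : SecondCountableTopology N) (_ : ChartedSpace (EuclideanSpace ℝ (Fin 4)) N) (_ : IsManifold (𝓡 4) ∞ N) (_ : CompactSpace N) (_ : SimplyConnectedSpace N) (oN : Literature.Topology.FourManifolds.SmoothOrientation (𝓡 4) N) (oS oP : Literature.Topology.FourManifolds.SmoothOrientation (𝓡 2) (Metric.sphere (0 : EuclideanSpace ℝ (Fin 3)) 1)) (S P : Literature.Topology.FourManifolds.FramedSphereFamily (𝓡 4) N (Fin 1) 2 2), Literature.Topology.FourManifolds.IsAlgebraicallyDual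 (𝓡 2) (𝓡 2) (𝓡 4) two_add_two_eq_four oS oP oN S.sphere P.sphere ∧ (Literature.Topology.FourManifolds.doublePoints (S.sphere 0) (P.sphere 0)).ncard = 3 ∧ P.IsSurgery (𝓡 4) (Metric.sphere (0 : EuclideanSpace ℝ (Fin 5)) 1) ∧ S.IsSurgery (𝓡 4) M) ∧ (∀ (M : Type) [TopologicalSpace M] [T2Space M] [SecondCountableTopology M] [ChartedSpace (EuclideanSpace ℝ (Fin 4)) M] [IsManifold (𝓡 4) ∞ M] (_ : M ≃ₕ Metric.sphere (0 : EuclideanSpace ℝ (Fin 5)) 1) (N : Type) [TopologicalSpace N] [T2Space N] [SecondCountableTopology N] [ChartedSpace (EuclideanSpace ℝ (Fin 4)) N] [IsManifold (𝓡 4) ∞ N] [CompactSpace N] [SimplyConnectedSpace N] (oN : Literature.Topology.FourManifolds.SmoothOrientation (𝓡 4) N) (oS oP : Literature.Topology.FourManifolds.SmoothOrientation (𝓡 2) (Metric.sphere (0 : EuclideanSpace ℝ (Fin 3)) 1)) (S P : Literature.Topology.FourManifolds.FramedSphereFamily (𝓡 4) N (Fin 1) 2 2), Literature.Topology.FourManifolds.IsAlgebraicallyDual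 (𝓡 2) (𝓡 2) (𝓡 4) two_add_two_eq_four oS oP oN S.sphere P.sphere → (Literature.Topology.FourManifolds.doublePoints (S.sphere 0) (P.sphere 0)).ncard = 3 → P.IsSurgery (𝓡 4) (Metric.sphere (0 : EuclideanSpace ℝ (Fin 5)) 1) → S.IsSurgery (𝓡 4) M → Nonempty (M ≃ₘ⟮𝓡 4, 𝓡 4⟯ Metric.sphere (0 : EuclideanSpace ℝ (Fin 5)) 1))

-- earlier SpherePresentation (stmt-SmoothPoincare4-7367, replaced 2026-08-15T16:53:19Z -> stmt-SmoothPoincare4-11167): retired by None — ∀ Q : Literature.Topology.FourManifolds.HomotopySphere 4, ∃ (N : Type) (_ : TopologicalSpace N) (_ : T2Space N) (_ : SecondCountableTopology N) (_ : ChartedSpace (EuclideanSpace ℝ (Fin 4)) N) (_ : IsManifold (𝓡 4) ∞ N) (_ : CompactSpace N) (_ : SimplyConnectedSpace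
/-- item stmt-SmoothPoincare4-11167 · crux · rank 2 · open · by planner
why it might fail: true on paper (KM63 p.504; Milnor65 Thm 3.13 + Kirby96 §2); the risk is formal: both inputs are UNPROVED named facts whose Lean forms (universe-u ∃-families, IsSurgery as open gluing, orientations, cobordism direction) must match this ∃-form — unprovable until Θ₄ and (B) land.
sources: KervaireMilnorAnnals1963, MilnorHCobordism1965, KirbyCorks1996, Matveyev1996, WallJLMS1964
[crux] FACT-GATE (placed first by the Phase-C rule: the assembly is conditional on two UNPROVED
named facts). Every smooth homotopy 4-sphere M ≃ₕ S⁴, with the Statement's own binders (M : Type,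
Hausdorff, second countable, C^∞ atlas modelled on ℝ⁴, e : M ≃ₕ S⁴; M is then compact — Hatcher
3.29, tree fact compactSpace_of_homotopyEquiv_sphere_four_holds — and simply connected by transport
along e; no packaging structure), admits an algebraically dual middle-level presentation from S⁴: a
closed simply connected smooth 4-manifold N, orientations, k, framed families S, P of k disjoint
2-spheres in N (Literature.Topology.FourManifolds.FramedSphereFamily), algebraically dual
(IsAlgebraicallyDual: transverse, Sᵢ·Pⱼ = δᵢⱼ), with S⁴ obtained from N by surgery along P and M by
surgery along S (FramedSphereFamily.IsSurgery). It is Θ₄ = 0 in h-cobordism form (named fact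
Literature.Topology.FourManifolds.isHCobordant_sphere_of_homotopySphere_four, UNPROVED: 4 open
leaves in ThetaFourKervaireMilnor.lean) + IsHCobordant.symm (proved) + two-three handle trading
(PROVED: exists_isMorseFunction_two_three_of_isHCobordism_holds) + the middle-level fact (B)
Literature.Topology.FourManifolds.exists_dualS -/
@[route_item "route-SmoothPoincare4-ThreePointSpheres", crux]
def SpherePresentation : Prop :=
  ∀ (M : Type) [TopologicalSpace M] [T2Space M] [SecondCountableTopology M] [ChartedSpace (EuclideanSpace ℝ (Fin 4)) M] [IsManifold (𝓡 4) ∞ M], M ≃ₕ Metric.sphere (0 : EuclideanSpace ℝ (Fin 5)) 1 → ∃ (N : Type) (_ : TopologicalSpace N) (_ : T2Space N) (_ : SecondCountableTopology N) (_ : ChartedSpace (EuclideanSpace ℝ (Fin 4)) N) (_ : IsManifold (𝓡 4) ∞ N) (_ : CompactSpace N) (_ : SimplyConnectedSpace N) (oN : Literature.Topology.FourManifolds.SmoothOrientation (𝓡 4) N) (oS oP : Literature.Topology.FourManifolds.SmoothOrientation (𝓡 2) (Metric.sphere (0 : EuclideanSpace ℝ (Fin 3)) 1)) (k : ℕ)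 (S P : Literature.Topology.FourManifolds.FramedSphereFamily (𝓡 4) N (Fin k) 2 2), Literature.Topology.FourManifolds.IsAlgebraicallyDual (𝓡 2) (𝓡 2) (𝓡 4) two_add_two_eq_four oS oP oN S.sphere P.sphere ∧ P.IsSurgery (𝓡 4) (Metric.sphere (0 : EuclideanSpace ℝ (Fin 5)) 1) ∧ S.IsSurgery (𝓡 4) M

-- earlier ThreePointCancellation (stmt-SmoothPoincare4-7368, replaced 2026-08-15T16:53:19Z -> stmt-SmoothPoincare4-11168): retired by None — ∀ (Q : Literature.Topology.FourManifolds.HomotopySphere 4) (N : Type) [TopologicalSpace N] [T2Space N] [SecondCountableTopology N] [ChartedSpace (EuclideanSpace ℝ (Fin 4)) N] [IsManifold (𝓡 4) ∞ N] [CompactSpace N] [SimplyConnectedSpace N] (oN : Literature.Topo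
/-- item stmt-SmoothPoincare4-11168 · crux · rank 3 · open · by planner
why it might fail: = SPC4 for P₀-twists: a three-point pair whose every Whitney disc meets S ∪ P inside (dual-invisible) escapes Gabai/Schwartz/KT light bulbs and may surger to an exotic S⁴; τ on ∂P₀ extends over neither side (Ladu Cor 1.3); the analogue is FALSE at b⁺ ≥ 1 (Akbulut cork twists are P₀-supported).
sources: Ladu2025ComplexityTwo, Gabai2020, Schwartz2021LightBulbDisks, KosanovicTeichner2021Disks, FreedmanGompfMorrisonWalker2010, Akbulut1991Fake
[crux] CANCEL₃ = RUNG(P₀) (card item K1, sphere form (b)): for every smooth homotopy 4-sphere M ≃ₕ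
S⁴ with the Statement's own binders (M : Type, Hausdorff, second countable, C^∞ atlas modelled on
ℝ⁴, e : M ≃ₕ S⁴; M is then compact — Hatcher 3.29, tree fact
compactSpace_of_homotopyEquiv_sphere_four_holds — and simply connected by transport along e; no
packaging structure), every closed simply connected smooth oriented 4-manifold N and ONE pair of
framed embedded 2-spheres S, P ⊂ N (FramedSphereFamily over Fin 1) that is algebraically dual
(transverse, S·P = 1) with exactly 3 double points, if surgery along P gives S⁴ and surgery along S
gives M then M ≃ₘ S⁴. Then N ≅ S²×S² with P isotopic to pt×S² and [S] = [S²×pt]; equivalently: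
h-cobordisms of Morgan–Szabó complexity 2 that start at S⁴ end at S⁴; every twist of S⁴ along Ladu's
protocork P₀ with simply connected result is S⁴ (this includes the Akbulut cork and the DHM cork
(1,0,1) in EVERY embedding into S⁴, Ladu2025ComplexityTwo §1). The mathematically hardest and most
informative item of the route. [difficulty: open-problem] -/
@[route_item "route-SmoothPoincare4-ThreePointSpheres", crux]
def ThreePointCancellation : Prop :=
  ∀ (M : Type) [TopologicalSpace M] [T2Space M] [SecondCountableTopology M] [ChartedSpace (EuclideanSpace ℝ (Fin 4)) M] [IsManifold (𝓡 4) ∞ M] (_ : M ≃ₕ Metric.sphere (0 : EuclideanSpace ℝ (Fin 5)) 1) (N : Type) [TopologicalSpace N] [T2Space N] [SecondCountableTopology N] [ChartedSpace (EuclideanSpace ℝ (Fin 4)) N] [IsManifold (𝓡 4) ∞ N] [CompactSpace N] [SimplyConnectedSpace N] (oN : Literature.Topology.FourManifolds.SmoothOrientation (𝓡 4) N) (oS oP : Literature.Topology.FourManifolds.SmoothOrientation (𝓡 2) (Metric.sphere (0 : EuclideanSpace ℝ (Fin 3)) 1)) (S P : Literature.Topology.FourManifolds.FramedSphereFamily (𝓡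 4) N (Fin 1) 2 2), Literature.Topology.FourManifolds.IsAlgebraicallyDual (𝓡 2) (𝓡 2) (𝓡 4) two_add_two_eq_four oS oP oN S.sphere P.sphere → (Literature.Topology.FourManifolds.doublePoints (S.sphere 0) (P.sphere 0)).ncard = 3 → P.IsSurgery (𝓡 4) (Metric.sphere (0 : EuclideanSpace ℝ (Fin 5)) 1) → S.IsSurgery (𝓡 4) M → Nonempty (M ≃ₘ⟮𝓡 4, 𝓡 4⟯ Metric.sphere (0 : EuclideanSpace ℝ (Fin 5)) 1)

-- earlier ThreePointDescent (stmt-SmoothPoincare4-7369, replaced 2026-08-15T16:53:19Z -> stmt-SmoothPoincare4-11169): retired by None — ∀ (Q : Literature.Topology.FourManifolds.HomotopySphere 4) (N : Type) [TopologicalSpace N] [T2Space N] [SecondCountableTopology N] [ChartedSpace (EuclideanSpace ℝ (Fin 4)) N] [IsManifold (𝓡 4) ∞ N] [CompactSpace N] [SimplyConnectedSpace N] (oN : Literature.Topology.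
/-- item stmt-SmoothPoincare4-11169 · crux · rank 4 · open · by planner
why it might fail: no complexity-REDUCING handle move is known; SW forces C > N at b⁺ ≥ 1 (MorganSzabo1999 Thm 1.1, Ladu2025 Thm 1.2) and even 'one 2- /3-handle pair suffices' is open for closed pairs (Schwartz2020 §2; false for corks, Kang2022): an exotic Σ needing two S²×S² summands or excess ≥ 4 refutes it.
sources: MorganSzabo1999, Ladu2025ComplexityTwo, Schwartz2020, Kang2022OneStabilization, Kreck2001, WallJLMS1964
[crux] DESCENT (card item K2, complexity reduction): every algebraically dual presentation (N, k, S,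
P) of a smooth homotopy 4-sphere M ≃ₕ S⁴ from S⁴ (as in SpherePresentation, same binders of the
Statement) can be replaced by one with k = 1 and exactly 3 double points presenting the same M from
S⁴. Equivalently: the minimum of the Morgan–Szabó complexity over h-cobordisms S⁴ → Σ is ≤ 2 (there
is one such h-cobordism up to diffeomorphism, Kreck2001, so: C(Z_Σ) ≤ 2 — every fake 4-sphere is a
P₀-twist of S⁴; C = 0 presentations are converted to three points by one finger move). Implies
Stabilisation's S1 (one S²×S² summand suffices) since N ≅ Σ # S²×S² ≅ S²×S². [difficulty:
open-problem] -/
@[route_item "route-SmoothPoincare4-ThreePointSpheres", crux]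
def ThreePointDescent : Prop :=
  ∀ (M : Type) [TopologicalSpace M] [T2Space M] [SecondCountableTopology M] [ChartedSpace (EuclideanSpace ℝ (Fin 4)) M] [IsManifold (𝓡 4) ∞ M] (_ : M ≃ₕ Metric.sphere (0 : EuclideanSpace ℝ (Fin 5)) 1) (N : Type) [TopologicalSpace N] [T2Space N] [SecondCountableTopology N] [ChartedSpace (EuclideanSpace ℝ (Fin 4)) N] [IsManifold (𝓡 4) ∞ N] [CompactSpace N] [SimplyConnectedSpace N] (oN : Literature.Topology.FourManifolds.SmoothOrientation (𝓡 4) N) (oS oP : Literature.Topology.FourManifolds.SmoothOrientation (𝓡 2) (Metric.sphere (0 : EuclideanSpace ℝ (Fin 3)) 1)) (k : ℕ) (S P : Literature.Topology.FourManifolds.FramedSphereFamily (𝓡 4) N (Fin k) 2 2), Literature.Topology.FourManifolds.IsAlgebraicallyDual (𝓡 2) (𝓡 2) (𝓡 4) two_add_two_eq_four oS oP oN S.sphere P.sphere → P.IsSurgery (𝓡 4) (Metric.sphere (0 : EuclideanSpace ℝ (Fin 5)) 1) → S.IsSurgery (𝓡 4) M → ∃ (N' : Type) (_ : TopologicalSpace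 N') (_ : T2Space N') (_ : SecondCountableTopology N') (_ : ChartedSpace (EuclideanSpace ℝ (Fin 4)) N') (_ : IsManifold (𝓡 4) ∞ N') (_ : CompactSpace N') (_ : SimplyConnectedSpace N') (oN' : Literature.Topology.FourManifolds.SmoothOrientation (𝓡 4) N') (oS' oP' : Literature.Topology.FourManifolds.SmoothOrientation (𝓡 2) (Metric.sphere (0 : EuclideanSpace ℝ (Fin 3)) 1)) (S' P' : Literature.Topology.FourManifolds.FramedSphereFamily (𝓡 4) N' (Fin 1) 2 2), Literature.Topology.FourManifolds.IsAlgebraicallyDual (𝓡 2) (𝓡 2) (𝓡 4) two_add_two_eq_four oS' oP' oN' S'.sphere P'.sphere ∧ (Literature.Topology.FourManifolds.doublePoints (S'.sphere 0) (P'.sphere 0)).ncard = 3 ∧ P'.IsSurgery (𝓡 4) (Metric.sphere (0 : EuclideanSpace ℝ (Fin 5)) 1) ∧ S'.IsSurgery (𝓡 4) M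

-- earlier OnePointCancellation (stmt-SmoothPoincare4-7370, replaced 2026-08-15T16:53:19Z -> stmt-SmoothPoincare4-11170): retired by None — ∀ (Q : Literature.Topology.FourManifolds.HomotopySphere 4) (N : Type) [TopologicalSpace N] [T2Space N] [SecondCountableTopology N] [ChartedSpace (EuclideanSpace ℝ (Fin 4)) N] [IsManifold (𝓡 4) ∞ N] [CompactSpace N] [SimplyConnectedSpace N] (oN : Literature.Topolo
/-- item stmt-SmoothPoincare4-11170 · support · rank 9 · open · by planner
sources: MilnorHCobordism1965, KirbyCorks1996, GompfStipsicz1999, Matveyev1996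
[support] rung C = 0 (calibration; the last step of any light-bulb proof of ThreePointCancellation,
after a Whitney move): the same data (M ≃ₕ S⁴ with the Statement's binders, N, one framed pair S, P)
with S, P GEOMETRICALLY dual (IsGeometricallyDual: algebraically dual with exactly one double point)
⇒ M ≃ₘ S⁴. Milnor's cancellation theorem read in the middle level: ν(S ∪ P) is a punctured S²×S², N
≅ N₀ # S²×S² with S, P the two factors, both surgeries return N₀, hence M ≅ N₀ ≅ S⁴
(MilnorHCobordism1965 Thms 5.4/6.4; KirbyCorks1996 §1 prototype; GompfStipsicz1999 §5.2). Known
mathematics; the formal work is the plumbing/gluing bookkeeping over IsSurgery. [difficulty: L] -/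
@[route_item "route-SmoothPoincare4-ThreePointSpheres"]
def OnePointCancellation : Prop :=
  ∀ (M : Type) [TopologicalSpace M] [T2Space M] [SecondCountableTopology M] [ChartedSpace (EuclideanSpace ℝ (Fin 4)) M] [IsManifold (𝓡 4) ∞ M] (_ : M ≃ₕ Metric.sphere (0 : EuclideanSpace ℝ (Fin 5)) 1) (N : Type) [TopologicalSpace N] [T2Space N] [SecondCountableTopology N] [ChartedSpace (EuclideanSpace ℝ (Fin 4)) N] [IsManifold (𝓡 4) ∞ N] [CompactSpace N] [SimplyConnectedSpace N] (oN : Literature.Topology.FourManifolds.SmoothOrientation (𝓡 4) N) (oS oP : Literature.Topology.FourManifolds.SmoothOrientation (𝓡 2) (Metric.sphere (0 : EuclideanSpace ℝ (Fin 3)) 1)) (S P : Literature.Topology.FourManifolds.FramedSphereFamily (𝓡 4) N (Fin 1) 2 2), Literature.Topology.FourManifolds.IsGeometricallyDual (𝓡 2) (𝓡 2) (𝓡 4) two_add_two_eq_four oS oP oN S.sphere P.sphere → P.IsSurgery (𝓡 4) (Metric.sphere (0 : EuclideanSpace ℝ (Fin 5)) 1) → S.IsSurgery (𝓡 4) M →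 Nonempty (M ≃ₘ⟮𝓡 4, 𝓡 4⟯ Metric.sphere (0 : EuclideanSpace ℝ (Fin 5)) 1)

/-- item stmt-SmoothPoincare4-7371 · assembly · rank 1 · open · by planner
sources: KervaireMilnorAnnals1963, Matveyev1996, Kirby1997
[assembly] ThreePointCancellation → ThreePointDescent → SpherePresentation → SmoothPoincare4
(package M as a HomotopySphere 4 by the two proved packaging facts, present, descend, cancel). -/
@[route_item "route-SmoothPoincare4-ThreePointSpheres"]
def Assembly : Prop :=
  ThreePointCancellation → ThreePointDescent → SpherePresentation → SmoothPoincare4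

/-! D-0027 §2.1 — DECIDING THEOREM (planner-authored via `route open/edit --closes-file`; by planner-rbadge-SmoothPoincare4-ThreePointSpher-d0607d66-g4-0 2026-08-15T16:53:19Z):
its hypotheses are this route's items and its conclusion the sub-problem Statement (glue_lint), and it elaborates with this file. -/

/-- D-0027 §2.1 deciding theorem of route ThreePointSpheres: pure logic. `SmoothPoincare4` unfolds to: for every
Hausdorff second-countable `M : Type`, every `C^∞` atlas on `M` modelled on `ℝ⁴` and every homotopy equivalence
`e : M ≃ₕ S⁴`, `Nonempty (M ≃ₘ⟮𝓡 4, 𝓡 4⟯ S⁴)`. Given `e`, `SpherePresentation` presents `M` from `S⁴` by an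
algebraically dual middle-level pair of framed sphere families, `ThreePointDescent` trades it for ONE pair with
exactly three double points, and `ThreePointCancellation` returns the diffeomorphism. `Target` (= the conjunction
DESCENT₃ ∧ CANCEL₃) and the support `OnePointCancellation` are deliberately not hypotheses. -/
@[closes "route-SmoothPoincare4-ThreePointSpheres"] theorem closes (hP : SpherePresentation) (hD : ThreePointDescent) (hC : ThreePointCancellation) :
    _root_.SmoothPoincare4 := by
  unfold _root_.SmoothPoincare4 Literature.SPC4.SmoothPoincareConjectureFour
    ContinuousMap.HomotopyEquiv.NonemptyDiffeomorphSphere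
  intro M _ _ _ _ _ e
  obtain ⟨N, _, _, _, _, _, _, _, oN, oS, oP, k, S, P, hdual, hPS, hSM⟩ := hP M e
  obtain ⟨N', _, _, _, _, _, _, _, oN', oS', oP', S', P', hdual', h3, hPS', hSM'⟩ :=
    hD M e N oN oS oP k S P hdual hPS hSM
  exact hC M e N' oN' oS' oP' S' P' hdual' h3 hPS' hSM'

end Summit.SmoothPoincare4.SmoothPoincare4.Theses.ThreePointSpheres
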